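import Mathlib.Algebra.Polynomial.Derivative
import Mathlib.Algebra.Polynomial.BigOperators
import Mathlib.Algebra.BigOperators.Intervals
import Mathlib.Data.Nat.Factorial.Basic
import Mathlib.Tactic.Ring
import Mathlib.Tactic.Linarith
import Mathlib.Tactic.FieldSimp
import Mathlib.Tactic.LinearCombination
import HarnessLib

/-!
# Linear differential operators with polynomial coefficients in an abstract differential algebra: the twist by `(X − 1)` and the reduction along an order-2 equation

`Literature/Algebra/Polynomial/DifferentialOperatorReduction.lean` — everything PROVED. The
purely algebraic skeleton of Beukers-type arguments ("a linear relation at a point comes from a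
functional relation"): identities between iterated derivatives which hold in EVERY commutative
`S[X]`-algebra `A` equipped with an additive map `D : A → A` satisfying the Leibniz rule and
`D (ι p) = ι (p′)` (`ι : S[X] →+* A`), with coefficients that are polynomials INDEPENDENT of `A`
— so that an identity established for a formal solution at one point (e.g. in `S⟦X⟧`) can be
replayed for local solutions at another point (e.g. in Laurent series `S⸨X − 1⸩`).

* `iterate_mul_of_deriv_eq_one`, `twist_identity` (§1): if `D t = 1` (think `t = X − 1`) then
  `t^{k+1} Dᵏ w = ∑_{j≤k} c_{kj} tʲ Dʲ(t w)` with universal integers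
  `c_{kj} = (−1)^{k−j} k!/j!` (`twistCoeff`); hence `(X−1)^{m+1} · Λ(w) = Λ̃((X−1) w)` for the
  twisted operator `Λ̃ = twistedOp m L` of `Λ = ∑_{k≤m} Lₖ ∂ᵏ` (`twistedOp_spec`, §3).
* `pow_mul_iterate_eq_of_order_two`, `pow_mul_opEval_eq_of_order_two` (§2): along a solution of
  `n₂ y″ + n₁ y′ + n₀ y = 0`, `n₂ᵏ y⁽ᵏ⁾ = aₖ y + bₖ y′` with `(aₖ, bₖ) = reducePair n₀ n₁ n₂ k`, and
  so `n₂ᵐ · Λ(y) = A y + B y′` with explicit polynomials `A, B` (the remainder of the right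
  division of `Λ` by the order-2 operator, without building the Ore ring `S(X)[∂]`).

Definitions: `twistCoeff`, `reducePair`, `twistedOp` (explicit formulas / recursions).
Used by `Literature/NumberTheory/Transcendental/FischlerRivoalCorollary1OfAndre.lean`.
-/

noncomputable section

open Finset Polynomial

namespace Literature.Algebra.Polynomial


variable {S : Type*} [CommRing S] {A : Type*} [CommRing A]

/-! ### 1. Iterated derivations: power rule and the linear-factor rule -/

section Derivation

variable (D : A →+ A) (hD : ∀ a b, D (a * b) = D a * b + a * D b)
include hD

/-- Power rule `D(aᵏ⁺¹) = (k+1) aᵏ D a`. [folklore] -/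
theorem map_pow_succ (a : A) (k : ℕ) : D (a ^ (k + 1)) = ((k : A) + 1) * a ^ k * D a := by
  induction k with
  | zero => simp
  | succ k ih =>
    rw [pow_succ, hD, ih]
    push_cast
    ring

/-- `D 1 = 0`. [folklore] -/
theorem map_one_eq_zero : D 1 = 0 := by
  have h := hD 1 1
  rw [mul_one, one_mul] at h
  linear_combination -h

/-- `D n = 0` for natural numbers `n`. [folklore] -/
theorem map_natCast_eq_zero (n : ℕ) : D (n : A) = 0 := by
  induction n with
  | zero => simp
  | succ n ih => rw [Nat.cast_succ, map_add, ih, map_one_eq_zero D hD, add_zero]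

/-- The linear-factor rule: if `D t = 1` then `Dᵏ⁺¹(t w) = t Dᵏ⁺¹ w + (k+1) Dᵏ w`. [folklore] -/
theorem iterate_mul_of_deriv_eq_one {t : A} (ht : D t = 1) (w : A) (k : ℕ) :
    D^[k + 1] (t * w) = t * D^[k + 1] w + ((k : A) + 1) * D^[k] w := by
  induction k with
  | zero => simp [hD, ht]; ring
  | succ k ih =>
    rw [Function.iterate_succ_apply', ih]
    simp only [Function.iterate_succ_apply']
    have hk : D ((k : A) + 1) = 0 := by
      rw [← Nat.cast_succ, map_natCast_eq_zero D hD]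
    rw [map_add, hD, hD, ht, hk]
    push_cast
    ring

/-- The universal integer coefficients of the twist: `c k j = (−1)^{k−j} k!/j!`. [folklore] -/
def twistCoeff (k j : ℕ) : ℤ := (-1) ^ (k - j) * (k.descFactorial (k - j) : ℤ)

omit hD in
/-- `c k k = 1`. [folklore] -/
theorem twistCoeff_self (k : ℕ) : twistCoeff k k = 1 := by
  simp [twistCoeff]

omit hD in
/-- The recursion `c (k+1) j = −(k+1) · c k j` for `j ≤ k`. [folklore] -/
theorem twistCoeff_succ {k j : ℕ} (hj : j ≤ k) :
    twistCoeff (k + 1) j = -((k : ℤ) + 1) * twistCoeff k j := by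
  simp only [twistCoeff]
  rw [show k + 1 - j = (k - j) + 1 by omega, Nat.succ_descFactorial_succ, pow_succ]
  push_cast
  ring

/-- **The twist identity**: if `D t = 1`, then for every `w`,
`t^{k+1} Dᵏ w = ∑_{j ≤ k} c_{kj} · t^j Dʲ(t w)` with the universal integers `c_{kj}`.
(Solving the triangular system `Dʲ(tw) = t Dʲ w + j Dʲ⁻¹ w` for the `Dᵏ w`.) [folklore] -/
theorem twist_identity {t : A} (ht : D t = 1) (w : A) (k : ℕ) :
    t ^ (k + 1) * D^[k] w =
      ∑ j ∈ Finset.range (k + 1), twistCoeff k j • (t ^ j * D^[j] (t * w)) := by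
  induction k with
  | zero =>
    rw [Finset.sum_range_one, twistCoeff_self, one_smul]
    simp
  | succ k ih =>
    -- `t D^{k+1} w = D^{k+1}(tw) − (k+1) D^k w`
    have h1 : t * D^[k + 1] w = D^[k + 1] (t * w) - ((k : A) + 1) * D^[k] w := by
      rw [iterate_mul_of_deriv_eq_one D hD ht]; ring
    have h2 : t ^ (k + 1 + 1) * D^[k + 1] w =
        t ^ (k + 1) * D^[k + 1] (t * w) - ((k : A) + 1) * (t ^ (k + 1) * D^[k] w) := by
      rw [pow_succ, mul_assoc, h1]; ring
    have hsum : ∑ j ∈ Finset.range (k + 1), twistCoeff (k + 1) j • (t ^ j * D^[j] (t * w)) =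
        ∑ j ∈ Finset.range (k + 1), -(((k : A) + 1) * (twistCoeff k j • (t ^ j * D^[j] (t * w)))) :=
      Finset.sum_congr rfl fun j hj => by
        rw [twistCoeff_succ (Nat.lt_succ_iff.mp (Finset.mem_range.mp hj))]
        simp only [zsmul_eq_mul]
        push_cast
        ring
    rw [h2, ih, Finset.sum_range_succ _ (k + 1), twistCoeff_self, one_smul, Finset.mul_sum, hsum,
      Finset.sum_neg_distrib]
    ring

end Derivation

/-! ### 2. Reduction of iterated derivatives along an order-2 equation -/

/-- The pair `(aₖ, bₖ)` with `n₂ᵏ Dᵏ y = aₖ y + bₖ D y` for solutions of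
`n₂ D²y + n₁ D y + n₀ y = 0`:  `a₀ = 1, b₀ = 0`, and
`a_{k+1} = n₂ aₖ′ − bₖ n₀ − k n₂′ aₖ`, `b_{k+1} = n₂ (aₖ + bₖ′) − bₖ n₁ − k n₂′ bₖ`. [folklore] -/
def reducePair (n₀ n₁ n₂ : S[X]) : ℕ → S[X] × S[X]
  | 0 => (1, 0)
  | k + 1 =>
    (n₂ * derivative (reducePair n₀ n₁ n₂ k).1 - (reducePair n₀ n₁ n₂ k).2 * n₀
        - (k : S[X]) * derivative n₂ * (reducePair n₀ n₁ n₂ k).1,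
      n₂ * ((reducePair n₀ n₁ n₂ k).1 + derivative (reducePair n₀ n₁ n₂ k).2)
        - (reducePair n₀ n₁ n₂ k).2 * n₁ - (k : S[X]) * derivative n₂ * (reducePair n₀ n₁ n₂ k).2)

section Reduce

variable (ι : S[X] →+* A) (D : A →+ A) (hD : ∀ a b, D (a * b) = D a * b + a * D b)
  (hι : ∀ p, D (ι p) = ι (derivative p))
include hD hι

/-- **Reduction along an order-2 equation** in any differential `S[X]`-algebra: if
`n₂ y″ + n₁ y′ + n₀ y = 0` then `n₂ᵏ y⁽ᵏ⁾ = aₖ y + bₖ y′` with `(aₖ, bₖ) = reducePair n₀ n₁ n₂ k`,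
polynomials independent of the algebra and of the solution. [folklore] -/
theorem pow_mul_iterate_eq_of_order_two (n₀ n₁ n₂ : S[X]) {y : A}
    (hy : ι n₂ * D (D y) + ι n₁ * D y + ι n₀ * y = 0) (k : ℕ) :
    ι n₂ ^ k * D^[k] y = ι (reducePair n₀ n₁ n₂ k).1 * y + ι (reducePair n₀ n₁ n₂ k).2 * D y := by
  induction k with
  | zero => simp [reducePair]
  | succ k ih =>
    -- apply `D` to the induction hypothesis and multiply by `ι n₂`
    have hDih := congrArg D ih
    rw [hD, map_add, hD, hD, hι, hι] at hDih
    have hy2 : ι n₂ * D (D y) = -(ι n₁ * D y) - ι n₀ * y := by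
      rw [eq_sub_iff_add_eq, eq_neg_iff_add_eq_zero, ← hy]; ring
    rcases k with _ | k
    · -- k = 0 → 1
      simp [reducePair]
    · have hpow : D (ι n₂ ^ (k + 1)) = ((k : A) + 1) * ι n₂ ^ k * D (ι n₂) :=
        map_pow_succ D hD (ι n₂) k
      rw [hpow, hι] at hDih
      -- multiply `hDih` by `ι n₂`
      have key := congrArg (fun x => ι n₂ * x) hDih
      -- goal
      rw [Function.iterate_succ_apply', show reducePair n₀ n₁ n₂ (k + 1 + 1) =
        (n₂ * derivative (reducePair n₀ n₁ n₂ (k + 1)).1 - (reducePair n₀ n₁ n₂ (k + 1)).2 * n₀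
          - ((k + 1 : ℕ) : S[X]) * derivative n₂ * (reducePair n₀ n₁ n₂ (k + 1)).1,
        n₂ * ((reducePair n₀ n₁ n₂ (k + 1)).1 + derivative (reducePair n₀ n₁ n₂ (k + 1)).2)
          - (reducePair n₀ n₁ n₂ (k + 1)).2 * n₁
          - ((k + 1 : ℕ) : S[X]) * derivative n₂ * (reducePair n₀ n₁ n₂ (k + 1)).2) from rfl]
      simp only [map_sub, map_mul, map_add, map_natCast]
      set a := ι (reducePair n₀ n₁ n₂ (k + 1)).1
      set b := ι (reducePair n₀ n₁ n₂ (k + 1)).2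
      set a' := ι (derivative (reducePair n₀ n₁ n₂ (k + 1)).1)
      set b' := ι (derivative (reducePair n₀ n₁ n₂ (k + 1)).2)
      -- from `key`: ι n₂ * ((k+1) ι n₂^k ι n₂' D^{k+1} y + ι n₂^{k+1} D^{k+2} y) = ι n₂ * (…)
      -- and `ih`: ι n₂^{k+1} D^{k+1} y = a y + b Dy
      have e1 : ι n₂ ^ (k + 1 + 1) * D (D^[k + 1] y) =
          ι n₂ * (a' * y + a * D y + (b' * D y + b * D (D y)))
            - ((k : A) + 1) * ι (derivative n₂) * (ι n₂ ^ (k + 1) * D^[k + 1] y) := by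
        have : ι n₂ * (((k : A) + 1) * ι n₂ ^ k * ι (derivative n₂) * D^[k + 1] y
            + ι n₂ ^ (k + 1) * D (D^[k + 1] y)) =
            ι n₂ * (a' * y + a * D y + (b' * D y + b * D (D y))) := key
        rw [pow_succ, pow_succ] at *
        linear_combination this
      rw [e1, ih]
      have e2 : ι n₂ * (b * D (D y)) = b * (-(ι n₁ * D y) - ι n₀ * y) := by
        rw [← hy2]; ring
      push_cast
      linear_combination e2

/-- **Reduction of a whole operator**: with `Λ = ∑_{j≤m} Lⱼ ∂ʲ`,
`n₂ᵐ · Λ(y) = A y + B y′` for every solution `y` of the order-2 equation, where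
`A = ∑ Lⱼ n₂^{m−j} aⱼ`, `B = ∑ Lⱼ n₂^{m−j} bⱼ` are polynomials independent of `y`. [folklore] -/
theorem pow_mul_opEval_eq_of_order_two (n₀ n₁ n₂ : S[X]) {y : A}
    (hy : ι n₂ * D (D y) + ι n₁ * D y + ι n₀ * y = 0) (m : ℕ) (L : ℕ → S[X]) :
    ι n₂ ^ m * ∑ j ∈ Finset.range (m + 1), ι (L j) * D^[j] y =
      ι (∑ j ∈ Finset.range (m + 1), L j * n₂ ^ (m - j) * (reducePair n₀ n₁ n₂ j).1) * y
        + ι (∑ j ∈ Finset.range (m + 1), L j * n₂ ^ (m - j) * (reducePair n₀ n₁ n₂ j).2) * D y := by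
  rw [Finset.mul_sum, map_sum, map_sum, Finset.sum_mul, Finset.sum_mul, ← Finset.sum_add_distrib]
  refine Finset.sum_congr rfl fun j hj => ?_
  have hjm : j ≤ m := Nat.lt_succ_iff.mp (Finset.mem_range.mp hj)
  have hred := pow_mul_iterate_eq_of_order_two ι D hD hι n₀ n₁ n₂ hy j
  have : ι n₂ ^ m = ι n₂ ^ (m - j) * ι n₂ ^ j := by
    rw [← pow_add, Nat.sub_add_cancel hjm]
  rw [this, map_mul, map_mul, map_mul, map_mul, map_pow]
  calc ι n₂ ^ (m - j) * ι n₂ ^ j * (ι (L j) * D^[j] y)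
      = ι (L j) * ι n₂ ^ (m - j) * (ι n₂ ^ j * D^[j] y) := by ring
    _ = ι (L j) * ι n₂ ^ (m - j) * (ι (reducePair n₀ n₁ n₂ j).1 * y
          + ι (reducePair n₀ n₁ n₂ j).2 * D y) := by rw [hred]
    _ = _ := by ring

end Reduce

/-! ### 3. The twisted operator -/

/-- **The twisted operator** `Λ'` of `Λ = ∑_{k≤m} Lₖ ∂ᵏ`: its coefficients
`L′ⱼ = ∑_{j ≤ k ≤ m} c_{kj} (X − 1)^{m−k+j} Lₖ`, designed so that
`(X − 1)^{m+1} · Λ(w) = Λ′((X − 1) w)` (`twistedOp_spec`). [folklore] -/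
def twistedOp (m : ℕ) (L : ℕ → S[X]) (j : ℕ) : S[X] :=
  ∑ k ∈ Finset.Ico j (m + 1), ((twistCoeff k j : ℤ) : S[X]) * (X - C 1) ^ (m - k + j) * L k

section Twist

variable (ι : S[X] →+* A) (D : A →+ A) (hD : ∀ a b, D (a * b) = D a * b + a * D b)
  (hι : ∀ p, D (ι p) = ι (derivative p))
include hD hι

/-- **`(X − 1)^{m+1} · Λ(w) = Λ′((X − 1)·w)`** in every differential `S[X]`-algebra: the operator
`Λ` applied to `w` is, up to the factor `(X−1)^{m+1}`, the twisted operator `Λ′ = twistedOp m L`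
applied to `(X − 1) w`. (Used with `w = g/(z−1)`: relations for `w` become relations for `g`.)
[folklore] -/
theorem twistedOp_spec (m : ℕ) (L : ℕ → S[X]) (w : A) :
    ι ((X - C 1) ^ (m + 1)) * ∑ k ∈ Finset.range (m + 1), ι (L k) * D^[k] w =
      ∑ j ∈ Finset.range (m + 1), ι (twistedOp m L j) * D^[j] (ι (X - C 1) * w) := by
  set t : A := ι (X - C 1) with ht_def
  have ht : D t = 1 := by rw [ht_def, hι]; simp
  -- left-hand side as a double sum over `j ≤ k ≤ m`
  have lhs : ι ((X - C 1) ^ (m + 1)) * ∑ k ∈ Finset.range (m + 1), ι (L k) * D^[k] w =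
      ∑ k ∈ Finset.range (m + 1), ∑ j ∈ Finset.range (k + 1),
        ι (L k) * t ^ (m - k) * (twistCoeff k j • (t ^ j * D^[j] (t * w))) := by
    rw [Finset.mul_sum]
    refine Finset.sum_congr rfl fun k hk => ?_
    have hkm : k ≤ m := Nat.lt_succ_iff.mp (Finset.mem_range.mp hk)
    rw [← Finset.mul_sum, ← twist_identity D hD ht w k, map_pow, ← ht_def]
    have : t ^ (m + 1) = t ^ (m - k) * t ^ (k + 1) := by
      rw [← pow_add]; congr 1; omega
    rw [this]; ring
  -- right-hand side as a double sum over `j ≤ k ≤ m`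
  have rhs : ∑ j ∈ Finset.range (m + 1), ι (twistedOp m L j) * D^[j] (t * w) =
      ∑ j ∈ Finset.range (m + 1), ∑ k ∈ Finset.Ico j (m + 1),
        ι (L k) * t ^ (m - k) * (twistCoeff k j • (t ^ j * D^[j] (t * w))) := by
    refine Finset.sum_congr rfl fun j hj => ?_
    rw [twistedOp, map_sum, Finset.sum_mul]
    refine Finset.sum_congr rfl fun k hk => ?_
    have hjk : j ≤ k := (Finset.mem_Ico.mp hk).1
    have hkm : k ≤ m := Nat.lt_succ_iff.mp (Finset.mem_Ico.mp hk).2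
    rw [map_mul, map_mul, map_pow, ← ht_def, map_intCast, zsmul_eq_mul,
      show m - k + j = (m - k) + j from rfl, pow_add]
    ring
  rw [lhs, rhs, Finset.range_eq_Ico]
  have := Finset.sum_Ico_Ico_comm 0 (m + 1)
    (fun j k => ι (L k) * t ^ (m - k) * (twistCoeff k j • (t ^ j * D^[j] (t * w))))
  simp only [Finset.range_eq_Ico] at this ⊢
  rw [this]

end Twist

end Literature.Algebra.Polynomial

end
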